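import Summits.HubbardSuperconductivity.HubbardSuperconductivity.Theorems.WeakCouplingBCSKlBlaschkeTransplantMap

/-!
KL-MARGIN-SCAN · reader idea-2 (lens «control») · round 5 — `Theorems/WeakCouplingBCSKlBlaschkeTransplantTargets.lean`
(helper, supports stmt-HubbardSuperconductivity-0158) — PART C of a pure three-file cut of the x-read prestage
91f4b14c7a1eabde (crit-1 KL STATUS l.10099; p1 pre-flight l.10122); PART A = `…Theorems/WeakCouplingBCSKlBlaschkeTransplant.lean`
(§0–§1 `klS klA klMuT klC mobius`, factorisation, `level_iff_mobius`), PART B = `…Theorems/WeakCouplingBCSKlBlaschkeTransplantMap.lean`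
(§2 Blaschke phase `β_a`, §3 transplant map `Φ_a`, level / Fermi-curve transplant, density identity).  No statement changed; 0 sorry.
  §4 TYPED TARGETS (Props over the tree's vocabulary, NOT proved here): T1 `TransplantsFermiMeasure`
     (Φ_a)_* σ[ε_{t′}, μ] = s⁻¹·σ[ε₀, μ̃] and its ∃-closure `KlBlaschkeTransplant`; T2 `TransplantsIntegrals` /
     `TransplantsDOS`; T3 `TransplantsChannelInf` (the `channelInf` transplant via `transplantedForm`); plus the
     PROVED order corollary `channelOrder_of_transplant` (channel order at (t′, μ) = order of the transplanted forms
     on the NN Fermi curve at μ̃, given T3 for both channels).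
Honest framing: nothing here is a statement about superconductivity; a Kohn–Luttinger statement is not ODLRO;
no margin, window, U₀ or K₃ claim is made.
-/

set_option linter.dupNamespace false
set_option linter.style.longLine false

noncomputable section

namespace Summit.HubbardSuperconductivity.HubbardSuperconductivity.Theorems.KlBlaschkeTransplant

open Real MeasureTheory Literature.MathematicalPhysics.QuantumLattice

variable {tp μ a : ℝ}

/-! ### §4 Typed targets (Props over the tree's vocabulary; NOT proved in this sketch) -/

/-- **T1 (measure isomorphism).** The pushforward of the t–t′ Fermi-curve measure `dℓ/|∇ε_{t′}|` at level `μ`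
under `Φ_a` is `s⁻¹` times the NN Fermi-curve measure at the transplanted level `μ̃`.  (Proof route: 1D area
formula on each D₄/graph chart exactly as `Literature…fermiCurveMeasure_eq_map`, with `transplant_density_const`
supplying the constant Radon–Nikodym factor.) -/
def TransplantsFermiMeasure (tp μ a : ℝ) : Prop :=
  Measure.map (blaschkeMap a) (fermiCurveMeasure (squareDispersion 1 tp) μ)
    = (ENNReal.ofReal (klS tp μ))⁻¹ • fermiCurveMeasure (squareDispersion 1 0) (klMuT tp μ)

/-- **T1, quantified** over the admissible window (inside the band, off the Van Hove level). -/
def KlBlaschkeTransplant : Prop :=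
  ∀ tp μ a : ℝ, |tp| < 1 / 2 → tp * μ < 1 → -4 - 4 * tp < μ → μ < 4 - 4 * tp → μ ≠ 4 * tp →
    |a| < 1 → 2 * a / (1 + a ^ 2) = klA tp μ → TransplantsFermiMeasure tp μ a

/-- **T2 (integrals).** Consequence of T1 by `lintegral_map` / `integral_map`; `F` measurable. -/
def TransplantsIntegrals (tp μ a : ℝ) : Prop :=
  ∀ F : Momentum → ℝ, Measurable F →
    ∫ k, F (blaschkeMap a k) ∂fermiCurveMeasure (squareDispersion 1 tp) μ
      = (klS tp μ)⁻¹ * ∫ q, F q ∂fermiCurveMeasure (squareDispersion 1 0) (klMuT tp μ)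

/-- **T2′ (density of states).** `N_{t′}(μ) = N₀(μ̃)/√(1 − t′μ)` — total masses in T1. -/
def TransplantsDOS (tp μ : ℝ) : Prop :=
  fermiCurveMeasure (squareDispersion 1 tp) μ Set.univ
    = (ENNReal.ofReal (klS tp μ))⁻¹ * fermiCurveMeasure (squareDispersion 1 0) (klMuT tp μ) Set.univ

/-- The transplanted Kohn–Luttinger form: the t–t′ kernel `Γ^{t′}_{μ,U}` read through `Φ_{−a} = Φ_a⁻¹` and
integrated against the NN Fermi-curve measure at `μ̃` (the kernel itself is NOT transplanted). -/
def transplantedForm (tp μ U a : ℝ) (ψ : Momentum → ℝ) : ℝ :=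
  ∫ q, ψ q * ∫ q', kohnLuttingerKernel (squareDispersion 1 tp) μ U (blaschkeMap (-a) q) (blaschkeMap (-a) q') * ψ q'
      ∂fermiCurveMeasure (squareDispersion 1 0) (klMuT tp μ) ∂fermiCurveMeasure (squareDispersion 1 0) (klMuT tp μ)

/-- **T3 (channel transplant).** Via `ψ = √s · ψ̃ ∘ Φ_a` (an isometry `L²(σ⁰_{μ̃}) → L²(σ_{t′,μ})` by T1 that
preserves every D₄ channel by `inChannel_comp_blaschkeMap`):
`channelInf(ε_{t′}, μ, U, χ) = s⁻¹ · inf { transplantedForm ψ̃ : ψ̃ a NN channel-χ state at μ̃ }`. -/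
def TransplantsChannelInf (tp μ U a : ℝ) (χ : D4Irrep) : Prop :=
  channelInf (squareDispersion 1 tp) μ U χ
    = (klS tp μ)⁻¹ * sInf ((transplantedForm tp μ U a) '' {ψ | IsChannelState (squareDispersion 1 0) (klMuT tp μ) χ ψ})

/-- CONTROL COROLLARY (proved from T3): the common factor `s⁻¹ > 0` drops out of every channel comparison, so
the channel ORDER at `(t′, μ, U)` is the order of the transplanted infima on the fixed NN state space at `μ̃`. -/
theorem channelOrder_of_transplant (hμ : tp * μ < 1) {U : ℝ} {χ χ' : D4Irrep}
    (h : TransplantsChannelInf tp μ U a χ) (h' : TransplantsChannelInf tp μ U a χ') :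
    channelInf (squareDispersion 1 tp) μ U χ < channelInf (squareDispersion 1 tp) μ U χ'
      ↔ sInf ((transplantedForm tp μ U a) '' {ψ | IsChannelState (squareDispersion 1 0) (klMuT tp μ) χ ψ})
        < sInf ((transplantedForm tp μ U a) '' {ψ | IsChannelState (squareDispersion 1 0) (klMuT tp μ) χ' ψ}) := by
  rw [h, h']
  exact mul_lt_mul_iff_of_pos_left (inv_pos.2 (klS_pos hμ))

end Summit.HubbardSuperconductivity.HubbardSuperconductivity.Theorems.KlBlaschkeTransplant

end
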